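import Literature.AlgebraicGeometry.Milne1999.SpecialLefschetzGroupOneEqUnitaryCentralizer
import Literature.AlgebraicGeometry.Milne1999.LefschetzGroupProducts
import Literature.AlgebraicGeometry.Milne1999.SpecialLefschetzGroupInvariantsCommutativeEnd
import Literature.AlgebraicGeometry.Milne1999.SpecialLefschetzGroupInvariantsHodgeClasses
import Literature.AlgebraicGeometry.HodgeTheory.MixedEllipticCurvesProductsHodgeClasses
import HarnessLib

/-!
# Milne 1999, Thm. 3.2 / Cor. 4.5 on a product `B × C` with `Hom(B, C) = 0`: the `S`-invariants of
# `H*(B × C) = H*(B) ⊗ H*(C)` are sums of tensors of invariants (Lemma 3.1), hence Lefschetz classes when they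
# are so on the factors (Prop. 3.4, start of proof)

Family `hodge`, layer `Literature/AlgebraicGeometry/Milne1999`, namespace
`Literature.AlgebraicGeometry.Milne1999` (D-0022). THEOREMS ONLY (no definition, no named fact, D-0026; net
debt 0). Written for the cell `pub-hodgecm2` (COR-CM), seat `lit-milne` (gen 45), binder table
`HOME/lit/milne.md` rows M2/M4. The cited record `Milne1999_specialLefschetzGroup_invariants_le`
(`Milne1999/LefschetzGroup`: for EVERY complex abelian variety `A`, the classes of `H²ᵖ(A(ℂ); ℂ)` fixed by
`specialLefschetzGroup (dim A) A.X` lie in `Dᵖ_hom(A)_ℂ`) is a tree theorem on three loci — commutative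
`End(A)` (`SpecialLefschetzGroupInvariantsCommutativeEnd`), CM type (`SpecialLefschetzGroupInvariantsCMType`),
`B(A) = D(A)` (`SpecialLefschetzGroupInvariantsHodgeClasses`). This file proves the FIRST REDUCTION STEP of
Milne's proof of Thm. 3.2 (Prop. 3.4, "Start of the proof", with Lemma 3.1) on the tree's carriers: the record
for a product `B × C` of Hom-orthogonal factors follows from the record (in its `S(ℂ)`-form read on `H¹`) for
`B` and for `C` — so the proved loci are closed under Hom-orthogonal products.

## Source, verbatim (held text `paper:doi-10-1215-s0012-7094-99-09620-5` = J. S. Milne, *Lefschetz classes on abelian varieties*, Duke Math. J. 96 (1999) 639–675; PDF page = printed page − 638)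

* §3, p. 652–653 (p0014 L33 – p0015 L12): "**Lemma 3.1.** Let `G` and `H` be algebraic groups over `k`
  acting on finite-dimensional `k`-vector spaces `V` and `W` respectively. Then `(V^G) ⊗_k k^al =
  (V ⊗_k k^al)^{G_{k^al}}` and `(V ⊗_k W)^{G × H} = V^G ⊗_k W^H`. Proof. […] Let `{f₁, f₂, …}` be a basis
  for `W`. Any element `x` of `V ⊗_k W` can be written uniquely `x = Σᵢ aᵢ ⊗ fᵢ` with `aᵢ ∈ V`. If `x` is
  fixed by all `(g, 1) ∈ G(k) × H(k)`, then `gaᵢ = aᵢ` for all `i`, and so `x ∈ V^G ⊗ W`. This shows that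
  `(V ⊗ W)^{G × 1} = V^G ⊗ W`, and similarly `(V^G ⊗ W)^{1 × H} = V^G ⊗ W^H`."
* §3, p. 654 (p0016 L12–L24): "**Start of the proof of Proposition 3.4.** It follows from Proposition 1.5
  that `S(A) = S(A^r)`, and so it suffices to prove the statement with `r = 1`. Moreover, an isogeny
  `A → A₁^{r₁} × ⋯ × A_s^{r_s}` with the `Aᵢ` simple and pairwise nonisogenous defines isomorphisms
  `H*(A) → H*(A₁^{r₁}) ⊗ ⋯ ⊗ H*(A_s^{r_s})` (see 1.5), `S(A) → S(A₁) × ⋯ × S(A_s)` and hence (by 3.1 and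
  induction) an isomorphism `H*(A)^{S(A)} → H*(A₁^{r₁})^{S(A₁)} ⊗ ⋯ ⊗ H*(A_s^{r_s})^{S(A_s)}`. If the
  proposition is true for each variety `Aᵢ^{rᵢ}`, so that each `k`-algebra `H*(Aᵢ^{rᵢ})^{S(Aᵢ)}` is
  generated by the vectors of degree `2` fixed by `S(Aᵢ)`, then it is clear that it is also true for `A`."
* §1, p. 643 (p0005 L17–L19): "Let `A = A₁ × ⋯ × A_s`. Then `C(A) ⊂ C(A₁) × ⋯ × C(A_s)`, with equality
  holding if and only if `Hom(Aᵢ, Aⱼ) = 0` for all `i, j`, `i ≠ j`." Prop. 1.5 (p. 644): "Any such isogeny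
  induces an isomorphism `S(A₁) × ⋯ × S(A_s) → S(A)`". p. 657 (p0019 L10–L11): "`−1 ∈ μ₂(ℚ)` acts as
  multiplication by `(−1)ⁱ` on `Hⁱ(A^r)`."
* Cor. 4.5 (p. 659): "For any abelian variety `A` and any `r ≥ 0`, `H^{2*}(A^r)(*)^{L(A)} = D_hom(A^r)_k`."

## What is proved (complex Betti cohomology of complex abelian varieties `B`, `C`; the tree's carriers)

Notation: `S(B)(ℂ) = unitaryCentralizerGroup B h_B` acting on `Hᵏ(B(ℂ); ℂ)` by `⋀ᵏu`
(`exteriorPullback`), `Dᵖ(B) ⊗ ℂ = divisorClassesSpan B.X (dim B) p`, `s ⊕ t = prodBlockDiagEquiv s t` on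
`H¹(B × C) = pr_B^* H¹(B) ⊕ pr_C^* H¹(C)`. "The record for `B` in `S(ℂ)`-form" means: for every `a`, every
class of `H^{2a}(B(ℂ); ℂ)` fixed by all `⋀^{2a}s`, `s ∈ S(B)(ℂ)`, lies in `Dᵃ(B) ⊗ ℂ` (hypotheses `recB`,
`recC`; tree theorems on the three loci above).

* §1 `exists_eq_sum_repr_smul_of_forall_eq_sum_repr_smul` — **Lemma 3.1 in coordinates** (pure linear
  algebra): if the coefficient family `(aᵢ)` of a tensor `Σᵢ aᵢ ⊗ bᵢ` (`b` a basis of `W`) satisfies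
  `a_{i'} = Σᵢ [T bᵢ]_{i'} aᵢ` for all `T` in a set `𝒯 ⊆ End W`, then `Σᵢ aᵢ ⊗ bᵢ = Σ_r e_r ⊗ c_r` with `e_r`
  in the span of the `aᵢ` and `T c_r = c_r` for all `T ∈ 𝒯`.
* §2 `neg_mem_unitaryCentralizerGroup`, `exteriorPullback_neg`, `eq_zero_of_forall_exteriorPullback_eq_of_odd` —
  `-1 ∈ S(A)(ℂ)` acts by `(-1)ᵏ` on `Hᵏ`, so odd-degree `S(A)(ℂ)`-invariants vanish (p. 657).
* §3 `kunnethSum_bijective` — Künneth with bases in iterated-sum form: every class of `Hᵏ((B × C)(ℂ); ℂ)` is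
  `Σ_{j ≤ k} Σᵢ pr_B^* a_{j,i} ∪ pr_C^* b_{j,i}` for unique coefficients `a_{j,i} ∈ H^{k-j}(B)` (bases `b_j` of
  the `Hʲ(C)`; the tree's `complexBetti_kunneth_bijective`, Hatcher 3.16);
  `exteriorPullback_prodBlockDiagEquiv_one_kunnethSum` / `exteriorPullback_one_prodBlockDiagEquiv_kunnethSum` —
  `⋀•(s ⊕ 1)` acts on the coefficients by `⋀•s`, `⋀•(1 ⊕ t)` through the matrices of the `⋀ʲt`.
* §4 **`mem_divisorClassesSpan_prod_of_forall_exteriorPullback_prodBlockDiagEquiv_eq`** — the heart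
  ("by 3.1 and induction"): given the records for `B` and `C` in `S(ℂ)`-form, every class of
  `H²ᵖ((B × C)(ℂ); ℂ)` fixed by `⋀^{2p}(s ⊕ t)` for all `s ∈ S(B)(ℂ)`, `t ∈ S(C)(ℂ)` lies in `Dᵖ(B × C) ⊗ ℂ`
  (no hypothesis relating `B` and `C`); `cupProduct_map_fst_map_snd_mem_divisorClassesSpan` — a cross product
  of invariants is a Lefschetz class (even degrees: pull-backs and products of divisor monomials; odd: zero).
* §5 `prodBlockDiagEquiv_mem_unitaryCentralizerGroup` — `s ⊕ t ∈ S(B × C)(ℂ)` for the product polarization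
  `pr_B^* h_B + pr_C^* h_C` when `Hom(B, C) = 0 = Hom(C, B)` (Prop. 1.5);
  `mem_divisorClassesSpan_prod_of_forall_exteriorPullback_eq` — the record for `B × C` in `S(ℂ)`-form;
  **`specialLefschetzGroup_invariants_le_prod`** — the CONCLUSION OF THE RECORD
  `Milne1999_specialLefschetzGroup_invariants_le` for `B × C` (classes fixed by
  `specialLefschetzGroup (dim (B × C)) (B × C).X` lie in `Dᵖ_hom(B × C)_ℂ`) from the `S(ℂ)`-form records of
  positive-dimensional Hom-orthogonal factors with polarization data (`h ∈ B¹ ⊗ ℂ`, `h^{dim} ≠ 0`, `Q_h`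
  non-degenerate) — through Thm. 4.4's `⋀•u ∈ ker l` (`exteriorPullbackEquiv_mem_specialLefschetzGroup`) on
  `B × C`; Cor. 4.5 set form; Prop. 4.8 (c) ⇒ (a) on `B × C`.
* §6 `exists_polarizationClass` (the class of a projective embedding carries all the polarization data),
  `specialLefschetzGroup_invariants_le_prod_of_exists`, and the NEW LOCI:
  `…_prod_of_forall_comp_comm_of_isDivisorGenerated` (`End(B)` commutative, `B(C) = D(C)`),
  `…_prod_of_isDivisorGenerated_of_forall_comp_comm`, `…_prod_of_isDivisorGenerated` (both `B = D` — their
  product need not be), `…_prod_of_forall_comp_comm`.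

UPSHOT: the locus where the record (`r = 1`) is a tree theorem is now closed under binary products of
Hom-orthogonal positive-dimensional members given with `S(ℂ)`-form records (commutative `End`, `B = D`, and —
through `SpecialLefschetzGroupInvariantsCMProducts` — CM); what remains of Milne's Thm. 3.2 is exactly the
isotypic case `Aᵢ^{rᵢ}` with `End⁰(Aᵢ)` non-commutative or `rᵢ ≥ 2` off these loci (Prop. 3.6: invariant
theory of `Sp`, `O`, `GL` with multiplicity), plus the transport along the isogeny `A → ∏ Aᵢ^{rᵢ}`.

NOT here: the isogeny transport of the `S(ℂ)`-form record (for CM factors see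
`SpecialLefschetzGroupInvariantsCMSimple`); `s`-fold products (iterate the binary case: the output of §5 has
the input shape, `prodPolarizationClass_mem_hodgeClassSpan` / `lefschetzPow_prodPolarizationClass_self_ne_zero` /
`eq_zero_of_forall_polarizationPairingOne_prod_eq_zero`); factors of dimension `0`; Prop. 3.6.

## References

* [Milne1999LefschetzClasses] J. S. Milne, Lefschetz classes on abelian varieties, Duke Math. J. 96 (1999)
  639–675: §1 p. 643 and Prop. 1.5, Lemma 3.1 (pp. 652–653), Thm. 3.2, Prop. 3.4 (start of proof, p. 654),
  p. 657, Thm. 4.4, Cor. 4.5 (p. 659), Prop. 4.8 (p. 660).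
* [HatcherAT2002] A. Hatcher, Algebraic Topology, CUP 2002, §3.2 Prop. 3.10, Thm. 3.16.
* [vanGeemen1994HodgeAV] B. van Geemen, An introduction to the Hodge conjecture for abelian varieties,
  LNM 1594 (1994), §2.4 (`D`, products of divisor classes).
* [VoisinHodgeI2002] C. Voisin, Hodge Theory and Complex Algebraic Geometry I, §3.1.3 Cor. 3.9, Thm. 6.25,
  §7.1.2 (polarization data of a projective embedding).
-/

noncomputable section

open CategoryTheory MonoidalCategory CartesianMonoidalCategory
open Literature.AlgebraicTopology.SingularHomology
open Literature.AlgebraicGeometry.HodgeTheory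
open Literature.AlgebraicGeometry.Motives
open Literature.AlgebraicGeometry.VanGeemen1994 (hodgeClassSpan pullbackOne)
open Literature.Barriers.HodgeConjecture (divisorClassesSpan)
open Literature.Geometry.Kaehler (lefschetzPow)

namespace Literature.AlgebraicGeometry.Milne1999

/-! ### §1 Linear algebra: Lemma 3.1 `(V ⊗ W)^{1 × H} = V ⊗ W^H` in coordinates -/

section LinearAlgebra

variable {K V W : Type*} [Field K] [AddCommGroup V] [Module K V] [AddCommGroup W] [Module K W]
  {σ : Type*} [Fintype σ]

/-- **Milne 1999, Lemma 3.1, the coordinate computation** ("Let `{f₁, f₂, …}` be a basis for `W`. Any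
element `x` of `V ⊗_k W` can be written uniquely `x = Σᵢ aᵢ ⊗ fᵢ` with `aᵢ ∈ V`. If `x` is fixed by all
`(g, 1) ∈ G(k) × H(k)`, then `gaᵢ = aᵢ` for all `i` […] and similarly `(V^G ⊗ W)^{1 × H} = V^G ⊗ W^H`"),
in the form used on Künneth coefficients: let `b` be a basis of `W` indexed by `σ`, `a : σ → V` a family
of "coefficients" of the tensor `x = Σᵢ aᵢ ⊗ bᵢ`, and `𝒯` a set of endomorphisms of `W` such that `x` is
fixed by every `1 ⊗ T` — in coordinates: `a_{i'} = Σᵢ [T bᵢ]_{i'} · aᵢ` for all `T ∈ 𝒯`, `i'`. Then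
`x = Σ_r e_r ⊗ c_r` for finitely many `e_r` in the span of the `aᵢ` and `c_r ∈ W` FIXED by every `T ∈ 𝒯`:
`aᵢ = Σ_r [c_r]ᵢ · e_r`. (Take a basis `e_r` of the span of the `aᵢ`; the `c_r` are the coordinate rows.)
[cite: Milne1999LefschetzClasses, Lemma 3.1 (proof, pp. 652–653)] -/
theorem exists_eq_sum_repr_smul_of_forall_eq_sum_repr_smul (b : Module.Basis σ K W) (a : σ → V)
    (𝒯 : Set (Module.End K W)) (h𝒯 : ∀ T ∈ 𝒯, ∀ i', a i' = ∑ i, b.repr (T (b i)) i' • a i) :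
    ∃ (R : ℕ) (e : Fin R → V) (c : Fin R → W),
      (∀ r, e r ∈ Submodule.span K (Set.range a)) ∧ (∀ T ∈ 𝒯, ∀ r, T (c r) = c r) ∧
        ∀ i, a i = ∑ r, b.repr (c r) i • e r := by
  classical
  -- a basis `ε` of the span `E` of the `aᵢ`
  set E : Submodule K V := Submodule.span K (Set.range a) with hE
  haveI : Module.Finite K E := Module.Finite.span_of_finite K (Set.finite_range a)
  set R := Module.finrank K E
  let ε : Module.Basis (Fin R) K E := Module.finBasis K E
  -- the `aᵢ` as elements of `E`, and their coordinate rows `λ r i`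
  let a' : σ → E := fun i ↦ ⟨a i, Submodule.subset_span ⟨i, rfl⟩⟩
  have ha' : ∀ i, ((a' i : E) : V) = a i := fun i ↦ rfl
  let lam : Fin R → σ → K := fun r i ↦ ε.repr (a' i) r
  refine ⟨R, fun r ↦ (ε r : V), fun r ↦ ∑ i, lam r i • b i, fun r ↦ (ε r).2, fun T hT r ↦ ?_, fun i ↦ ?_⟩
  · -- `T c_r = c_r`: the coordinate rows satisfy `λ_{r i'} = Σᵢ [T bᵢ]_{i'} λ_{r i}`
    have hrow : ∀ i', lam r i' = ∑ i, b.repr (T (b i)) i' * lam r i := by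
      intro i'
      -- apply `ε.repr (·) r` to the hypothesis, read in `E`
      have hEq : a' i' = ∑ i, b.repr (T (b i)) i' • a' i := by
        apply Subtype.ext
        rw [ha', h𝒯 T hT i', Submodule.coe_sum]
        refine Finset.sum_congr rfl fun i _ ↦ ?_
        rw [Submodule.coe_smul]
      have e := congrArg (fun v : E ↦ ε.repr v r) hEq
      simp only [map_sum, map_smul, Finsupp.coe_finsetSum, Finsupp.coe_smul, Finset.sum_apply,
        Pi.smul_apply, smul_eq_mul] at e
      simpa [lam] using e
    calc T (∑ i, lam r i • b i) = ∑ i, lam r i • T (b i) := by rw [map_sum]; simp_rw [map_smul]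
      _ = ∑ i, lam r i • ∑ i', b.repr (T (b i)) i' • b i' := by
          refine Finset.sum_congr rfl fun i _ ↦ ?_
          rw [b.sum_repr (T (b i))]
      _ = ∑ i', (∑ i, b.repr (T (b i)) i' * lam r i) • b i' := by
          simp_rw [Finset.smul_sum, smul_smul]
          rw [Finset.sum_comm]
          refine Finset.sum_congr rfl fun i' _ ↦ ?_
          rw [Finset.sum_smul]
          refine Finset.sum_congr rfl fun i _ ↦ ?_
          rw [mul_comm]
      _ = ∑ i', lam r i' • b i' := by simp_rw [← hrow]
  · -- `aᵢ = Σ_r [c_r]ᵢ e_r` with `[c_r]ᵢ = λ_{r i}`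
    have hrepr : ∀ r, b.repr (∑ i, lam r i • b i) i = lam r i := fun r ↦ by
      rw [b.repr_sum_self]
    simp_rw [hrepr]
    have e := congrArg (fun v : E ↦ (v : V)) (ε.sum_repr (a' i)).symm
    simp only [Submodule.coe_sum, Submodule.coe_smul] at e
    exact e

/-- The vectors fixed by a family of linear maps form a subspace; in particular every element of the
span of fixed vectors is fixed. [cite: Milne1999LefschetzClasses, Lemma 3.1 (p. 652: "The set of vectors in V fixed by G is a subspace of V")] -/
theorem apply_eq_self_of_mem_span_of_forall_apply_eq_self {ι : Type*} (L : Module.End K V) (a : ι → V)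
    (ha : ∀ i, L (a i) = a i) {v : V} (hv : v ∈ Submodule.span K (Set.range a)) : L v = v := by
  induction hv using Submodule.span_induction with
  | mem x hx => obtain ⟨i, rfl⟩ := hx; exact ha i
  | zero => exact map_zero L
  | add x y _ _ hx hy => rw [map_add, hx, hy]
  | smul t x _ hx => rw [map_smul, hx]

end LinearAlgebra

/-! ### §2 `-1 ∈ S(A)(ℂ)` and the exterior action of a scalar -/

section Scalar

variable {A : AbelianVariety ℂ} {h : complexBetti A.X 2}

/-- **`-1 ∈ S(A)(ℂ)`**: `-1 ∈ C(A)` commutes with every `φ^*` and preserves every bilinear pairing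
(`Q_h(-x, -y) = Q_h(x, y)`) — Milne p. 657: "`S(A) = μ₂`" for a supersingular elliptic curve, and
`μ₂ ⊆ S(A)` always. [cite: Milne1999LefschetzClasses, §1 p. 644 (S(A)) and §3 p. 657] -/
theorem neg_mem_unitaryCentralizerGroup : LinearEquiv.neg ℂ ∈ unitaryCentralizerGroup A h := by
  refine ⟨fun φ x ↦ ?_, fun x y ↦ ?_⟩
  · rw [LinearEquiv.neg_apply, LinearEquiv.neg_apply, map_neg]
  · rw [LinearEquiv.neg_apply, LinearEquiv.neg_apply, map_neg, map_neg, LinearMap.neg_apply, neg_neg]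

/-- **`⋀ᵏ(-1) = (-1)ᵏ`** on `Hᵏ(A(ℂ); ℂ)` (multilinearity of `v₁ ∪ ⋯ ∪ v_k`; Milne p. 657: "`−1 ∈ μ₂(ℚ)`
acts as multiplication by `(−1)ⁱ` on `Hⁱ(A^r)`"). [cite: Milne1999LefschetzClasses, §3 p. 657]
[cite: HatcherAT2002, §3.2 Prop. 3.10] -/
theorem exteriorPullback_neg (k : ℕ) (x : complexBetti A.X k) :
    exteriorPullback (AbelianVariety.hasExteriorCohomologyH1_complexPoints A)
        ((LinearEquiv.neg ℂ : complexBetti A.X 1 ≃ₗ[ℂ] complexBetti A.X 1) :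
          complexBetti A.X 1 →ₗ[ℂ] complexBetti A.X 1) k x = ((-1 : ℂ) ^ k) • x := by
  have hA := AbelianVariety.hasExteriorCohomologyH1_complexPoints A
  suffices hs : exteriorPullback hA
      ((LinearEquiv.neg ℂ : complexBetti A.X 1 ≃ₗ[ℂ] complexBetti A.X 1) :
        complexBetti A.X 1 →ₗ[ℂ] complexBetti A.X 1) k = ((-1 : ℂ) ^ k) • LinearMap.id from
    LinearMap.congr_fun hs x
  refine exteriorPullback_ext hA fun v ↦ ?_
  rw [exteriorPullback_cupPowOne, LinearMap.smul_apply, LinearMap.id_apply]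
  have hv : (fun i ↦ ((LinearEquiv.neg ℂ : complexBetti A.X 1 ≃ₗ[ℂ] complexBetti A.X 1) :
      complexBetti A.X 1 →ₗ[ℂ] complexBetti A.X 1) (v i)) = fun i ↦ (-1 : ℂ) • v i := by
    funext i
    rw [LinearEquiv.coe_coe, LinearEquiv.neg_apply, neg_one_smul]
  rw [hv, MultilinearMap.map_smul_univ, Finset.prod_const, Finset.card_univ, Fintype.card_fin]

/-- **In odd degree only `0` is `S(A)(ℂ)`-invariant**: a class of `H^k(A(ℂ); ℂ)`, `k` odd, fixed by `⋀ᵏu`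
for all `u ∈ S(A)(ℂ)` vanishes (`u = -1` acts by `-1`). [cite: Milne1999LefschetzClasses, §3 p. 657] -/
theorem eq_zero_of_forall_exteriorPullback_eq_of_odd {k : ℕ} (hk : Odd k) {x : complexBetti A.X k}
    (hx : ∀ u ∈ unitaryCentralizerGroup A h,
      exteriorPullback (AbelianVariety.hasExteriorCohomologyH1_complexPoints A)
        (u : complexBetti A.X 1 →ₗ[ℂ] complexBetti A.X 1) k x = x) : x = 0 := by
  have e := hx _ neg_mem_unitaryCentralizerGroup
  rw [exteriorPullback_neg, hk.neg_one_pow, neg_one_smul] at e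
  -- `-x = x` forces `x = 0` in characteristic zero
  have h2 : (2 : ℂ) • x = 0 := by rw [two_smul]; nth_rw 1 [← e]; exact neg_add_cancel x
  exact (smul_eq_zero.1 h2).resolve_left two_ne_zero

end Scalar

/-! ### §3 Künneth coordinates on `H*(B × C)` and the action of `⋀•(s ⊕ t)` on them -/

section Kunneth

variable {B C : AbelianVariety ℂ} {σ : Fin (2 * C.dim + 1) → Type} [∀ j, Fintype (σ j)]
  (b : (j : Fin (2 * C.dim + 1)) → Module.Basis (σ j) ℂ (complexBetti C.X j)) (k : ℕ)

/-- The first projection of `B × C` as a morphism of schemes is the cartesian `fst` (`rfl`). [folklore] -/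
private theorem fst_hom_eq' (B C : AbelianVariety ℂ) : (AbelianVariety.fst B C).hom.hom.hom = fst B.X C.X := rfl

/-- The second projection of `B × C` as a morphism of schemes is the cartesian `snd` (`rfl`). [folklore] -/
private theorem snd_hom_eq' (B C : AbelianVariety ℂ) : (AbelianVariety.snd B C).hom.hom.hom = snd B.X C.X := rfl

/-- **Künneth with bases, iterated-sum form** (Hatcher Thm. 3.16 for `(B × C)(ℂ) = B(ℂ) × C(ℂ)`, the
tree's `complexBetti_kunneth_bijective` re-indexed from `{J : Σ j, σ j // J.1 ≤ k}` to `Σ_{j ≤ k} Σ_{i}`):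
every class of `Hᵏ((B × C)(ℂ); ℂ)` is `Σ_{j ≤ k} Σ_i pr_B^* a_{j,i} ∪ pr_C^* b_{j,i}` for a UNIQUE family of
coefficients `a_{j,i} ∈ H^{k-j}(B(ℂ); ℂ)` (Milne, proof of Prop. 3.4: "`H*(A) → H*(A₁^{r₁}) ⊗ ⋯ ⊗ H*(A_s^{r_s})`";
Lemma 3.1: "Any element `x` of `V ⊗_k W` can be written uniquely `x = Σᵢ aᵢ ⊗ fᵢ`").
[cite: HatcherAT2002, §3.2 Thm. 3.16] [cite: Milne1999LefschetzClasses, Lemma 3.1 and Prop. 3.4 (proof, pp. 652–654)] -/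
theorem kunnethSum_bijective :
    Function.Bijective (fun (a : (j : {j : Fin (2 * C.dim + 1) // (j : ℕ) ≤ k}) → σ j.1 →
        complexBetti B.X (k - (j.1 : ℕ))) ↦
      ∑ j : {j : Fin (2 * C.dim + 1) // (j : ℕ) ≤ k}, ∑ i : σ j.1,
        cupProduct (Nat.sub_add_cancel j.2)
          (complexBetti.map (AbelianVariety.fst B C).hom.hom.hom (k - (j.1 : ℕ)) (a j i))
          (complexBetti.map (AbelianVariety.snd B C).hom.hom.hom (j.1 : ℕ) (b j.1 i))) := by
  classical
  have hY : IsSmoothProjective B.dim B.X := AbelianVariety.isSmoothProjective_holds (A := B)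
  have hZ : IsSmoothProjective C.dim C.X := AbelianVariety.isSmoothProjective_holds (A := C)
  let d : (Σ j : Fin (2 * C.dim + 1), σ j) → ℕ := fun J ↦ (J.1 : ℕ)
  have hbij := complexBetti_kunneth_bijective hY hZ b k
  rw [← fst_hom_eq', ← snd_hom_eq'] at hbij
  -- re-indexing `Σ_{j ≤ k} σ j ≃ {J // d J ≤ k}` and the matching equivalence of coefficient families
  let e : (Σ j : {j : Fin (2 * C.dim + 1) // (j : ℕ) ≤ k}, σ j.1) ≃ LerayHirsch.Idx d k :=
    { toFun := fun J ↦ ⟨⟨J.1.1, J.2⟩, J.1.2⟩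
      invFun := fun J ↦ ⟨⟨J.1.1, J.2⟩, J.1.2⟩
      left_inv := fun _ ↦ rfl
      right_inv := fun _ ↦ rfl }
  let E : ((j : {j : Fin (2 * C.dim + 1) // (j : ℕ) ≤ k}) → σ j.1 → complexBetti B.X (k - (j.1 : ℕ))) ≃
      LerayHirsch.Src ℂ d (ComplexPoints B.X) k :=
    { toFun := fun a J ↦ a ⟨J.1.1, J.2⟩ J.1.2
      invFun := fun a' j i ↦ a' ⟨⟨j.1, i⟩, j.2⟩
      left_inv := fun _ ↦ rfl
      right_inv := fun _ ↦ rfl }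
  have key : ∀ a : (j : {j : Fin (2 * C.dim + 1) // (j : ℕ) ≤ k}) → σ j.1 → complexBetti B.X (k - (j.1 : ℕ)),
      (∑ j : {j : Fin (2 * C.dim + 1) // (j : ℕ) ≤ k}, ∑ i : σ j.1,
        cupProduct (Nat.sub_add_cancel j.2)
          (complexBetti.map (AbelianVariety.fst B C).hom.hom.hom (k - (j.1 : ℕ)) (a j i))
          (complexBetti.map (AbelianVariety.snd B C).hom.hom.hom (j.1 : ℕ) (b j.1 i))) = LerayHirsch.lhMap ℂ d
      (AlgPoints.mapContinuous (L := ℂ) (AbelianVariety.fst B C).hom.hom.hom)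
      (fun J ↦ complexBetti.map (AbelianVariety.snd B C).hom.hom.hom J.1 (b J.1 J.2)) k (E a) := by
    intro a
    rw [LerayHirsch.lhMap_eq_sum_idx]
    refine Eq.trans ?_ (Fintype.sum_equiv e _ _ fun x ↦ rfl)
    rw [Fintype.sum_sigma]
    rfl
  have hfun : (fun (a : (j : {j : Fin (2 * C.dim + 1) // (j : ℕ) ≤ k}) → σ j.1 →
        complexBetti B.X (k - (j.1 : ℕ))) ↦
      ∑ j : {j : Fin (2 * C.dim + 1) // (j : ℕ) ≤ k}, ∑ i : σ j.1,
        cupProduct (Nat.sub_add_cancel j.2)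
          (complexBetti.map (AbelianVariety.fst B C).hom.hom.hom (k - (j.1 : ℕ)) (a j i))
          (complexBetti.map (AbelianVariety.snd B C).hom.hom.hom (j.1 : ℕ) (b j.1 i))) = (LerayHirsch.lhMap ℂ d
      (AlgPoints.mapContinuous (L := ℂ) (AbelianVariety.fst B C).hom.hom.hom)
      (fun J ↦ complexBetti.map (AbelianVariety.snd B C).hom.hom.hom J.1 (b J.1 J.2)) k) ∘ E :=
    funext key
  rw [hfun]
  exact hbij.comp E.bijective

variable {b k}

/-- **`⋀•(s ⊕ 1)` acts on the Künneth coefficients**: `⋀ᵏ(s ⊕ 1)(Σ pr_B^* a_{j,i} ∪ pr_C^* b_{j,i}) =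
Σ pr_B^* (⋀^{k-j}s a_{j,i}) ∪ pr_C^* b_{j,i}` (the Künneth step `exteriorPullback_prodBlockDiagEquiv_cross`
with `⋀ʲ1 = 1`; Milne: "with `G` acting through its action on each `Hᵢ`").
[cite: Milne1999LefschetzClasses, Lemma 3.1 and Prop. 3.6 (proof)] [cite: HatcherAT2002, §3.2 Thm. 3.16] -/
theorem exteriorPullback_prodBlockDiagEquiv_one_kunnethSum (s : complexBetti B.X 1 ≃ₗ[ℂ] complexBetti B.X 1)
    (a : (j : {j : Fin (2 * C.dim + 1) // (j : ℕ) ≤ k}) → σ j.1 → complexBetti B.X (k - (j.1 : ℕ))) :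
    exteriorPullback (AbelianVariety.hasExteriorCohomologyH1_complexPoints (B.prod C))
        (prodBlockDiagEquiv s 1).toLinearMap k
        (∑ j : {j : Fin (2 * C.dim + 1) // (j : ℕ) ≤ k}, ∑ i : σ j.1,
          cupProduct (Nat.sub_add_cancel j.2)
            (complexBetti.map (AbelianVariety.fst B C).hom.hom.hom (k - (j.1 : ℕ)) (a j i))
            (complexBetti.map (AbelianVariety.snd B C).hom.hom.hom (j.1 : ℕ) (b j.1 i))) =
      ∑ j : {j : Fin (2 * C.dim + 1) // (j : ℕ) ≤ k}, ∑ i : σ j.1,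
        cupProduct (Nat.sub_add_cancel j.2)
          (complexBetti.map (AbelianVariety.fst B C).hom.hom.hom (k - (j.1 : ℕ))
            (exteriorPullback (AbelianVariety.hasExteriorCohomologyH1_complexPoints B)
              s.toLinearMap (k - (j.1 : ℕ)) (a j i)))
          (complexBetti.map (AbelianVariety.snd B C).hom.hom.hom (j.1 : ℕ) (b j.1 i)) := by
  rw [map_sum]
  refine Finset.sum_congr rfl fun j _ ↦ ?_
  rw [map_sum]
  refine Finset.sum_congr rfl fun i _ ↦ ?_
  rw [exteriorPullback_prodBlockDiagEquiv_cross,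
    show (1 : complexBetti C.X 1 ≃ₗ[ℂ] complexBetti C.X 1).toLinearMap = LinearMap.id from rfl,
    exteriorPullback_id, LinearMap.id_apply]

/-- **`⋀•(1 ⊕ t)` acts on the Künneth coefficients through the matrices of the `⋀ʲt`**:
`⋀ᵏ(1 ⊕ t)(Σ pr_B^* a_{j,i} ∪ pr_C^* b_{j,i}) = Σ_{j,i'} pr_B^* (Σ_i [⋀ʲt b_{j,i}]_{i'} a_{j,i}) ∪ pr_C^* b_{j,i'}`
(expand `⋀ʲt b_{j,i}` in the basis `b_j` and collect). [cite: Milne1999LefschetzClasses, Lemma 3.1 and Prop. 3.6 (proof)]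
[cite: HatcherAT2002, §3.2 Thm. 3.16] -/
theorem exteriorPullback_one_prodBlockDiagEquiv_kunnethSum (t : complexBetti C.X 1 ≃ₗ[ℂ] complexBetti C.X 1)
    (a : (j : {j : Fin (2 * C.dim + 1) // (j : ℕ) ≤ k}) → σ j.1 → complexBetti B.X (k - (j.1 : ℕ))) :
    exteriorPullback (AbelianVariety.hasExteriorCohomologyH1_complexPoints (B.prod C))
        (prodBlockDiagEquiv 1 t).toLinearMap k
        (∑ j : {j : Fin (2 * C.dim + 1) // (j : ℕ) ≤ k}, ∑ i : σ j.1,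
          cupProduct (Nat.sub_add_cancel j.2)
            (complexBetti.map (AbelianVariety.fst B C).hom.hom.hom (k - (j.1 : ℕ)) (a j i))
            (complexBetti.map (AbelianVariety.snd B C).hom.hom.hom (j.1 : ℕ) (b j.1 i))) =
      ∑ j : {j : Fin (2 * C.dim + 1) // (j : ℕ) ≤ k}, ∑ i' : σ j.1,
        cupProduct (Nat.sub_add_cancel j.2)
          (complexBetti.map (AbelianVariety.fst B C).hom.hom.hom (k - (j.1 : ℕ))
            (∑ i : σ j.1, (b j.1).repr
              (exteriorPullback (AbelianVariety.hasExteriorCohomologyH1_complexPoints C) t.toLinearMap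
                (j.1 : ℕ) (b j.1 i)) i' • a j i))
          (complexBetti.map (AbelianVariety.snd B C).hom.hom.hom (j.1 : ℕ) (b j.1 i')) := by
  rw [map_sum]
  refine Finset.sum_congr rfl fun j _ ↦ ?_
  -- the common value `Σ_{i'} Σ_i [⋀ʲt b_{j,i}]_{i'} • (pr_B^* a_{j,i} ∪ pr_C^* b_{j,i'})`
  set X : σ j.1 → σ j.1 → complexBetti (B.prod C).X k := fun i i' ↦
    cupProduct (Nat.sub_add_cancel j.2)
      (complexBetti.map (AbelianVariety.fst B C).hom.hom.hom (k - (j.1 : ℕ)) (a j i))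
      (complexBetti.map (AbelianVariety.snd B C).hom.hom.hom (j.1 : ℕ) (b j.1 i')) with hX
  set r : σ j.1 → σ j.1 → ℂ := fun i i' ↦ (b j.1).repr
    (exteriorPullback (AbelianVariety.hasExteriorCohomologyH1_complexPoints C) t.toLinearMap (j.1 : ℕ)
      (b j.1 i)) i' with hr
  -- left: `Σ_i pr_B^* a_{j,i} ∪ pr_C^* (⋀ʲt b_{j,i})`, expanded in the basis `b_j`
  have hL : ∀ i : σ j.1, exteriorPullback (AbelianVariety.hasExteriorCohomologyH1_complexPoints (B.prod C))
      (prodBlockDiagEquiv 1 t).toLinearMap k (X i i) = ∑ i', r i i' • X i i' := by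
    intro i
    rw [hX]
    dsimp only
    rw [exteriorPullback_prodBlockDiagEquiv_cross,
      show (1 : complexBetti B.X 1 ≃ₗ[ℂ] complexBetti B.X 1).toLinearMap = LinearMap.id from rfl,
      exteriorPullback_id, LinearMap.id_apply]
    conv_lhs => rw [← (b j.1).sum_repr (exteriorPullback (AbelianVariety.hasExteriorCohomologyH1_complexPoints C)
      t.toLinearMap (j.1 : ℕ) (b j.1 i))]
    rw [map_sum, map_sum]
    refine Finset.sum_congr rfl fun i' _ ↦ ?_
    rw [map_smul, map_smul]
  -- right: `Σ_{i'} pr_B^* (Σ_i r_{i i'} a_{j,i}) ∪ pr_C^* b_{j,i'}`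
  have hR : ∀ i' : σ j.1, cupProduct (Nat.sub_add_cancel j.2)
      (complexBetti.map (AbelianVariety.fst B C).hom.hom.hom (k - (j.1 : ℕ)) (∑ i, r i i' • a j i))
      (complexBetti.map (AbelianVariety.snd B C).hom.hom.hom (j.1 : ℕ) (b j.1 i')) = ∑ i, r i i' • X i i' := by
    intro i'
    rw [map_sum, map_sum, LinearMap.sum_apply]
    refine Finset.sum_congr rfl fun i _ ↦ ?_
    rw [map_smul, map_smul, LinearMap.smul_apply]
  calc exteriorPullback (AbelianVariety.hasExteriorCohomologyH1_complexPoints (B.prod C))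
        (prodBlockDiagEquiv 1 t).toLinearMap k (∑ i, X i i)
      = ∑ i, ∑ i', r i i' • X i i' := by rw [map_sum]; exact Finset.sum_congr rfl fun i _ ↦ hL i
    _ = ∑ i', ∑ i, r i i' • X i i' := Finset.sum_comm
    _ = _ := (Finset.sum_congr rfl fun i' _ ↦ (hR i').symm)

end Kunneth

/-! ### §4 Lemma 3.1 on `B × C`: the `S(B) × S(C)`-invariants are the tensors of invariants, hence Lefschetz -/

section Core

variable {B C : AbelianVariety ℂ} {hB : complexBetti B.X 2} {hC : complexBetti C.X 2}

/-- **A cross product `pr_B^* e ∪ pr_C^* c` of invariants is a Lefschetz class of `B × C`** when the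
`S`-invariants of the factors are Lefschetz: for `e ∈ Hⁱ(B(ℂ); ℂ)` fixed by all `⋀ⁱs`, `s ∈ S(B)(ℂ)`, and
`c ∈ Hʲ(C(ℂ); ℂ)` fixed by all `⋀ʲt`, `t ∈ S(C)(ℂ)`, `i + j = 2p`: if `i`, `j` are even, `e ∈ D^{i/2}(B) ⊗ ℂ`
and `c ∈ D^{j/2}(C) ⊗ ℂ` by hypothesis and pull-backs and products of divisor monomials are divisor
monomials; if `i` is odd, `e = 0` (`-1 ∈ S(B)`). Milne: "`H*(A)^{S(A)} → H*(A₁^{r₁})^{S(A₁)} ⊗ ⋯`", "If the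
proposition is true for each variety `Aᵢ^{rᵢ}` […] it is also true for `A`".
[cite: Milne1999LefschetzClasses, Prop. 3.4 (start of proof, p. 654) and Lemma 3.1] [cite: vanGeemen1994HodgeAV, §2.4] -/
theorem cupProduct_map_fst_map_snd_mem_divisorClassesSpan
    (recB : ∀ (a : ℕ) (y : complexBetti B.X (2 * a)), (∀ s ∈ unitaryCentralizerGroup B hB,
      exteriorPullback (AbelianVariety.hasExteriorCohomologyH1_complexPoints B)
        (s : complexBetti B.X 1 →ₗ[ℂ] complexBetti B.X 1) (2 * a) y = y) → y ∈ divisorClassesSpan B.X B.dim a)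
    (recC : ∀ (a : ℕ) (z : complexBetti C.X (2 * a)), (∀ t ∈ unitaryCentralizerGroup C hC,
      exteriorPullback (AbelianVariety.hasExteriorCohomologyH1_complexPoints C)
        (t : complexBetti C.X 1 →ₗ[ℂ] complexBetti C.X 1) (2 * a) z = z) → z ∈ divisorClassesSpan C.X C.dim a)
    {i j p : ℕ} (hij : i + j = 2 * p) {e : complexBetti B.X i} {c : complexBetti C.X j}
    (he : ∀ s ∈ unitaryCentralizerGroup B hB,
      exteriorPullback (AbelianVariety.hasExteriorCohomologyH1_complexPoints B)
        (s : complexBetti B.X 1 →ₗ[ℂ] complexBetti B.X 1) i e = e)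
    (hc : ∀ t ∈ unitaryCentralizerGroup C hC,
      exteriorPullback (AbelianVariety.hasExteriorCohomologyH1_complexPoints C)
        (t : complexBetti C.X 1 →ₗ[ℂ] complexBetti C.X 1) j c = c) :
    cupProduct hij (complexBetti.map (AbelianVariety.fst B C).hom.hom.hom i e)
      (complexBetti.map (AbelianVariety.snd B C).hom.hom.hom j c) ∈
      divisorClassesSpan (B.prod C).X (B.prod C).dim p := by
  rcases Nat.even_or_odd i with ⟨a₀, ha₀⟩ | hodd
  · obtain ⟨a, rfl⟩ : ∃ a, i = 2 * a := ⟨a₀, by omega⟩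
    obtain ⟨a', rfl⟩ : ∃ a', j = 2 * a' := ⟨p - a, by omega⟩
    exact cupProduct_mem_divisorClassesSpan_of_mem (show a + a' = p by omega) hij
      (AbelianVariety.map_mem_divisorClassesSpan (AbelianVariety.fst B C) (recB a e he))
      (AbelianVariety.map_mem_divisorClassesSpan (AbelianVariety.snd B C) (recC a' c hc))
  · rw [eq_zero_of_forall_exteriorPullback_eq_of_odd hodd he, map_zero, map_zero, LinearMap.zero_apply]
    exact Submodule.zero_mem _

/-- **Milne 1999, Thm. 3.2 / Cor. 4.5 on `B × C` from the factors — Lemma 3.1 with Prop. 3.4's reduction,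
the `S(B)(ℂ) × S(C)(ℂ)`-invariant form.** Let `h_B`, `h_C` be classes on `B`, `C` such that the
`S(B)(ℂ)`-invariants (`unitaryCentralizerGroup B h_B`, acting by `⋀•`) of every `H^{2a}(B(ℂ); ℂ)` lie in
`Dᵃ(B) ⊗ ℂ`, and likewise for `C`. Then every class `x ∈ H²ᵖ((B × C)(ℂ); ℂ)` fixed by `⋀^{2p}(s ⊕ t)` for all
`s ∈ S(B)(ℂ)`, `t ∈ S(C)(ℂ)` lies in `Dᵖ(B × C) ⊗ ℂ`. Proof (Milne's): expand `x` in Künneth coordinates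
against bases of `H*(C)` (`kunnethSum_bijective`); `s ⊕ 1` acts on the coefficients, which are therefore
`S(B)`-invariant; `1 ⊕ t` acts through the matrices of `⋀ʲt`, so by Lemma 3.1
(`exists_eq_sum_repr_smul_of_forall_eq_sum_repr_smul`) `x = Σ pr_B^* e_r ∪ pr_C^* c_r` with `e_r`
`S(B)`-invariant and `c_r` `S(C)`-invariant; each term is Lefschetz
(`cupProduct_map_fst_map_snd_mem_divisorClassesSpan`).
[cite: Milne1999LefschetzClasses, Lemma 3.1 (pp. 652–653), Prop. 3.4 (start of proof, p. 654), Cor. 4.5 (p. 659)] -/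
theorem mem_divisorClassesSpan_prod_of_forall_exteriorPullback_prodBlockDiagEquiv_eq
    (recB : ∀ (a : ℕ) (y : complexBetti B.X (2 * a)), (∀ s ∈ unitaryCentralizerGroup B hB,
      exteriorPullback (AbelianVariety.hasExteriorCohomologyH1_complexPoints B)
        (s : complexBetti B.X 1 →ₗ[ℂ] complexBetti B.X 1) (2 * a) y = y) → y ∈ divisorClassesSpan B.X B.dim a)
    (recC : ∀ (a : ℕ) (z : complexBetti C.X (2 * a)), (∀ t ∈ unitaryCentralizerGroup C hC,
      exteriorPullback (AbelianVariety.hasExteriorCohomologyH1_complexPoints C)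
        (t : complexBetti C.X 1 →ₗ[ℂ] complexBetti C.X 1) (2 * a) z = z) → z ∈ divisorClassesSpan C.X C.dim a)
    (p : ℕ) (x : complexBetti (B.prod C).X (2 * p))
    (hx : ∀ s ∈ unitaryCentralizerGroup B hB, ∀ t ∈ unitaryCentralizerGroup C hC,
      exteriorPullback (AbelianVariety.hasExteriorCohomologyH1_complexPoints (B.prod C))
        (prodBlockDiagEquiv s t).toLinearMap (2 * p) x = x) :
    x ∈ divisorClassesSpan (B.prod C).X (B.prod C).dim p := by
  classical
  -- bases of the `Hʲ(C(ℂ); ℂ)`, `j ≤ 2 dim C`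
  have hZ : IsSmoothProjective C.dim C.X := AbelianVariety.isSmoothProjective_holds (A := C)
  haveI := fun j ↦ finite_complexBetti hZ j
  let N : Fin (2 * C.dim + 1) → ℕ := fun j ↦ Module.finrank ℂ (complexBetti C.X j)
  let bC : (j : Fin (2 * C.dim + 1)) → Module.Basis (Fin (N j)) ℂ (complexBetti C.X j) :=
    fun j ↦ Module.finBasis ℂ (complexBetti C.X j)
  set hBB := AbelianVariety.hasExteriorCohomologyH1_complexPoints B with hBB_def
  set hCC := AbelianVariety.hasExteriorCohomologyH1_complexPoints C with hCC_def
  -- the Künneth sum and the coordinates of `x`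
  let Ψ : ((j : {j : Fin (2 * C.dim + 1) // (j : ℕ) ≤ 2 * p}) → Fin (N j.1) →
      complexBetti B.X (2 * p - (j.1 : ℕ))) → complexBetti (B.prod C).X (2 * p) := fun a ↦
    ∑ j : {j : Fin (2 * C.dim + 1) // (j : ℕ) ≤ 2 * p}, ∑ i : Fin (N j.1),
      cupProduct (Nat.sub_add_cancel j.2)
        (complexBetti.map (AbelianVariety.fst B C).hom.hom.hom (2 * p - (j.1 : ℕ)) (a j i))
        (complexBetti.map (AbelianVariety.snd B C).hom.hom.hom (j.1 : ℕ) (bC j.1 i))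
  have hΨ : Function.Bijective Ψ := kunnethSum_bijective bC (2 * p)
  obtain ⟨a, ha⟩ := hΨ.2 x
  -- (i) the coefficients are `S(B)`-invariant (`s ⊕ 1`)
  have hinvB : ∀ j i, ∀ s ∈ unitaryCentralizerGroup B hB,
      exteriorPullback hBB s.toLinearMap (2 * p - (j.1 : ℕ)) (a j i) = a j i := by
    intro j i s hs
    have h1 := hx s hs 1 (one_mem _)
    rw [← ha] at h1
    have h2 := (exteriorPullback_prodBlockDiagEquiv_one_kunnethSum (b := bC) (k := 2 * p) s a).symm.trans h1
    exact congrFun (congrFun (hΨ.1 h2) j) i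
  -- (ii) `1 ⊕ t` acts on the coefficients through the matrix of `⋀ʲt`
  have hmat : ∀ t ∈ unitaryCentralizerGroup C hC, ∀ j i',
      a j i' = ∑ i, (bC j.1).repr (exteriorPullback hCC t.toLinearMap (j.1 : ℕ) (bC j.1 i)) i' • a j i := by
    intro t ht j i'
    have h1 := hx 1 (one_mem _) t ht
    rw [← ha] at h1
    have h2 := (exteriorPullback_one_prodBlockDiagEquiv_kunnethSum (b := bC) (k := 2 * p) t a).symm.trans h1
    exact (congrFun (congrFun (hΨ.1 h2) j) i').symm
  -- (iii) Lemma 3.1, degree by degree: `Σ_i a_{j,i} ⊗ b_{j,i} = Σ_r e_{j,r} ⊗ c_{j,r}` with invariant `e`, `c`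
  have hT : ∀ j : {j : Fin (2 * C.dim + 1) // (j : ℕ) ≤ 2 * p},
      ∃ (R : ℕ) (e : Fin R → complexBetti B.X (2 * p - (j.1 : ℕ))) (c : Fin R → complexBetti C.X (j.1 : ℕ)),
        (∀ r, ∀ s ∈ unitaryCentralizerGroup B hB,
            exteriorPullback hBB (s : complexBetti B.X 1 →ₗ[ℂ] complexBetti B.X 1) (2 * p - (j.1 : ℕ)) (e r) =
              e r) ∧
          (∀ r, ∀ t ∈ unitaryCentralizerGroup C hC,
            exteriorPullback hCC (t : complexBetti C.X 1 →ₗ[ℂ] complexBetti C.X 1) (j.1 : ℕ) (c r) = c r) ∧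
          ∀ i, a j i = ∑ r, (bC j.1).repr (c r) i • e r := by
    intro j
    obtain ⟨R, e, c, he, hc, hae⟩ := exists_eq_sum_repr_smul_of_forall_eq_sum_repr_smul (bC j.1) (a j)
      {T | ∃ t ∈ unitaryCentralizerGroup C hC, T = exteriorPullback hCC t.toLinearMap (j.1 : ℕ)}
      (by rintro T ⟨t, ht, rfl⟩ i'; exact hmat t ht j i')
    exact ⟨R, e, c,
      fun r s hs ↦ apply_eq_self_of_mem_span_of_forall_apply_eq_self _ (a j) (fun i ↦ hinvB j i s hs) (he r),
      fun r t ht ↦ hc _ ⟨t, ht, rfl⟩ r, hae⟩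
  choose R e c he hc hae using hT
  -- (iv) regroup: `x = Σ_j Σ_r pr_B^* e_{j,r} ∪ pr_C^* c_{j,r}`
  have hx' : x = ∑ j : {j : Fin (2 * C.dim + 1) // (j : ℕ) ≤ 2 * p}, ∑ r : Fin (R j),
      cupProduct (Nat.sub_add_cancel j.2)
        (complexBetti.map (AbelianVariety.fst B C).hom.hom.hom (2 * p - (j.1 : ℕ)) (e j r))
        (complexBetti.map (AbelianVariety.snd B C).hom.hom.hom (j.1 : ℕ) (c j r)) := by
    rw [← ha]
    refine Finset.sum_congr rfl fun j _ ↦ ?_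
    -- abbreviate the cross products `X v w = pr_B^* v ∪ pr_C^* w`
    set X : complexBetti B.X (2 * p - (j.1 : ℕ)) → complexBetti C.X (j.1 : ℕ) → complexBetti (B.prod C).X (2 * p) :=
      fun v w ↦ cupProduct (Nat.sub_add_cancel j.2)
        (complexBetti.map (AbelianVariety.fst B C).hom.hom.hom (2 * p - (j.1 : ℕ)) v)
        (complexBetti.map (AbelianVariety.snd B C).hom.hom.hom (j.1 : ℕ) w) with hXdef
    have hX1 : ∀ (ι' : Type) (S : Finset ι') (f : ι' → ℂ) (v : ι' → complexBetti B.X (2 * p - (j.1 : ℕ))) w,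
        X (∑ l ∈ S, f l • v l) w = ∑ l ∈ S, f l • X (v l) w := by
      intro ι' S f v w
      rw [hXdef]
      dsimp only
      rw [map_sum, map_sum, LinearMap.sum_apply]
      refine Finset.sum_congr rfl fun l _ ↦ ?_
      rw [map_smul, map_smul, LinearMap.smul_apply]
    have hX2 : ∀ (ι' : Type) (S : Finset ι') (f : ι' → ℂ) (v) (w : ι' → complexBetti C.X (j.1 : ℕ)),
        X v (∑ l ∈ S, f l • w l) = ∑ l ∈ S, f l • X v (w l) := by
      intro ι' S f v w
      rw [hXdef]
      dsimp only
      rw [map_sum, map_sum]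
      refine Finset.sum_congr rfl fun l _ ↦ ?_
      rw [map_smul, map_smul]
    calc ∑ i : Fin (N j.1), X (a j i) (bC j.1 i)
        = ∑ i : Fin (N j.1), ∑ r : Fin (R j), (bC j.1).repr (c j r) i • X (e j r) (bC j.1 i) := by
          refine Finset.sum_congr rfl fun i _ ↦ ?_
          rw [hae j i, hX1]
      _ = ∑ r : Fin (R j), ∑ i : Fin (N j.1), (bC j.1).repr (c j r) i • X (e j r) (bC j.1 i) := Finset.sum_comm
      _ = ∑ r : Fin (R j), X (e j r) (c j r) := by
          refine Finset.sum_congr rfl fun r _ ↦ ?_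
          rw [← hX2]
          congr 1
          exact (bC j.1).sum_repr (c j r)
  rw [hx']
  refine Submodule.sum_mem _ fun j _ ↦ Submodule.sum_mem _ fun r _ ↦ ?_
  exact cupProduct_map_fst_map_snd_mem_divisorClassesSpan recB recC (Nat.sub_add_cancel j.2) (he j r) (hc j r)

end Core

/-! ### §5 The `S(B × C)(ℂ)`-form (`Hom(B, C) = 0 = Hom(C, B)`: `s ⊕ t ∈ S(B × C)`) and the record for `B × C` -/

section Product

variable {B C : AbelianVariety ℂ} {hB : complexBetti B.X 2} {hC : complexBetti C.X 2}

/-- **`s ⊕ t ∈ S(B × C)(ℂ)` for `s ∈ S(B)(ℂ)`, `t ∈ S(C)(ℂ)` when `Hom(B, C) = 0 = Hom(C, B)`** (Milne Prop. 1.5,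
binary case: "`S(A₁) × ⋯ × S(A_s) → S(A)` is an isomorphism"), for the product polarization class
`pr_B^* h_B + pr_C^* h_C` with `h_B^{dim B} ≠ 0 ≠ h_C^{dim C}` (the tree's `prodBlockDiagEquiv_mem_centralizerGroup`
and `mem_unitaryCentralizerGroup_prod_iff`). [cite: Milne1999LefschetzClasses, §1 p. 643 and Prop. 1.5] -/
theorem prodBlockDiagEquiv_mem_unitaryCentralizerGroup (hBC : ∀ f : B ⟶ C, f = 0) (hCB : ∀ g : C ⟶ B, g = 0)
    (hBtop : lefschetzPow hB (B.dim - 1) 2 hB ≠ 0) (hCtop : lefschetzPow hC (C.dim - 1) 2 hC ≠ 0)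
    {s : complexBetti B.X 1 ≃ₗ[ℂ] complexBetti B.X 1} (hs : s ∈ unitaryCentralizerGroup B hB)
    {t : complexBetti C.X 1 ≃ₗ[ℂ] complexBetti C.X 1} (ht : t ∈ unitaryCentralizerGroup C hC) :
    prodBlockDiagEquiv s t ∈ unitaryCentralizerGroup (B.prod C) (prodPolarizationClass B C hB hC) := by
  have hc : prodBlockDiagEquiv s t ∈ centralizerGroup (B.prod C) :=
    prodBlockDiagEquiv_mem_centralizerGroup hBC hCB (unitaryCentralizerGroup_le_centralizerGroup hs)
      (unitaryCentralizerGroup_le_centralizerGroup ht)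
  refine (mem_unitaryCentralizerGroup_prod_iff hBtop hCtop ⟨_, hc⟩).2 ⟨?_, ?_⟩
  · rw [centralizerGroup.restrictFstHom_prodBlockDiagEquiv]; exact hs
  · rw [centralizerGroup.restrictSndHom_prodBlockDiagEquiv]; exact ht

/-- **Milne 1999, Thm. 3.2 / Cor. 4.5 for `B × C` from the factors, the `S(B × C)(ℂ)`-form** — Prop. 3.4,
start of proof ("an isogeny `A → A₁^{r₁} × ⋯ × A_s^{r_s}` […] defines isomorphisms
`H*(A) → H*(A₁^{r₁}) ⊗ ⋯ ⊗ H*(A_s^{r_s})`, `S(A) → S(A₁) × ⋯ × S(A_s)` and hence (by 3.1 and induction) an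
isomorphism `H*(A)^{S(A)} → H*(A₁^{r₁})^{S(A₁)} ⊗ ⋯`. If the proposition is true for each variety `Aᵢ^{rᵢ}`
[…] then it is clear that it is also true for `A`"), binary case on the carriers: for `Hom(B, C) = 0 = Hom(C, B)`
and classes `h_B`, `h_C` with non-zero top powers such that the `S`-invariants of the factors are Lefschetz,
every class of `H²ᵖ((B × C)(ℂ); ℂ)` fixed by `⋀^{2p}u` for all
`u ∈ S(B × C)(ℂ) = unitaryCentralizerGroup (B × C) (pr_B^* h_B + pr_C^* h_C)` lies in `Dᵖ(B × C) ⊗ ℂ`.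
[cite: Milne1999LefschetzClasses, Prop. 3.4 (start of proof, p. 654), Lemma 3.1, Prop. 1.5, Cor. 4.5 (p. 659)] -/
theorem mem_divisorClassesSpan_prod_of_forall_exteriorPullback_eq
    (hBC : ∀ f : B ⟶ C, f = 0) (hCB : ∀ g : C ⟶ B, g = 0)
    (hBtop : lefschetzPow hB (B.dim - 1) 2 hB ≠ 0) (hCtop : lefschetzPow hC (C.dim - 1) 2 hC ≠ 0)
    (recB : ∀ (a : ℕ) (y : complexBetti B.X (2 * a)), (∀ s ∈ unitaryCentralizerGroup B hB,
      exteriorPullback (AbelianVariety.hasExteriorCohomologyH1_complexPoints B)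
        (s : complexBetti B.X 1 →ₗ[ℂ] complexBetti B.X 1) (2 * a) y = y) → y ∈ divisorClassesSpan B.X B.dim a)
    (recC : ∀ (a : ℕ) (z : complexBetti C.X (2 * a)), (∀ t ∈ unitaryCentralizerGroup C hC,
      exteriorPullback (AbelianVariety.hasExteriorCohomologyH1_complexPoints C)
        (t : complexBetti C.X 1 →ₗ[ℂ] complexBetti C.X 1) (2 * a) z = z) → z ∈ divisorClassesSpan C.X C.dim a)
    (p : ℕ) (x : complexBetti (B.prod C).X (2 * p))
    (hx : ∀ u ∈ unitaryCentralizerGroup (B.prod C) (prodPolarizationClass B C hB hC),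
      exteriorPullback (AbelianVariety.hasExteriorCohomologyH1_complexPoints (B.prod C))
        (u : complexBetti (B.prod C).X 1 →ₗ[ℂ] complexBetti (B.prod C).X 1) (2 * p) x = x) :
    x ∈ divisorClassesSpan (B.prod C).X (B.prod C).dim p :=
  mem_divisorClassesSpan_prod_of_forall_exteriorPullback_prodBlockDiagEquiv_eq recB recC p x
    fun _ hs _ ht ↦ hx _ (prodBlockDiagEquiv_mem_unitaryCentralizerGroup hBC hCB hBtop hCtop hs ht)

/-- **The conclusion of the record `Milne1999_specialLefschetzGroup_invariants_le` (Cor. 4.5 with Thm. 4.4 and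
Thm. 3.2) for `B × C`, PROVED from the factors** (`Hom(B, C) = 0 = Hom(C, B)`, `0 < dim B`, `0 < dim C`):
if `B` and `C` carry classes `h ∈ B¹ ⊗ ℂ` with `h^{dim} ≠ 0` and `Q_h` non-degenerate on `H¹` (polarization
classes) for which the `S(ℂ)`-invariants of `H^{2a}` lie in `Dᵃ ⊗ ℂ` (the `S(ℂ)`-form of the record on the
factors — a tree theorem for `End` commutative, CM type, `B = D`, …), then every class of
`H²ᵖ((B × C)(ℂ); ℂ)` fixed by `specialLefschetzGroup (dim (B × C)) (B × C).X` lies in `Dᵖ_hom(B × C)_ℂ`.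
The elements `⋀•u`, `u ∈ S(B × C)(ℂ)`, lie in the special Lefschetz group of `B × C`
(`exteriorPullbackEquiv_mem_specialLefschetzGroup`, with the product class in `B¹`, its top power non-zero
and `Q` non-degenerate: `prodPolarizationClass_mem_hodgeClassSpan`,
`lefschetzPow_prodPolarizationClass_self_ne_zero`, `eq_zero_of_forall_polarizationPairingOne_prod_eq_zero`),
so the `S(B × C)(ℂ)`-form applies. [cite: Milne1999LefschetzClasses, Prop. 3.4 (p. 654), Lemma 3.1, Prop. 1.5, Thm. 4.4, Cor. 4.5 (p. 659)] -/
theorem specialLefschetzGroup_invariants_le_prod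
    (hBC : ∀ f : B ⟶ C, f = 0) (hCB : ∀ g : C ⟶ B, g = 0) (hB0 : 0 < B.dim) (hC0 : 0 < C.dim)
    (hhB : hB ∈ hodgeClassSpan B.dim B.X 1) (hBtop : lefschetzPow hB (B.dim - 1) 2 hB ≠ 0)
    (hndB : ∀ z : complexBetti B.X 1, (∀ y, polarizationPairingOne B.X hB (B.dim - 1) z y = 0) → z = 0)
    (recB : ∀ (a : ℕ) (y : complexBetti B.X (2 * a)), (∀ s ∈ unitaryCentralizerGroup B hB,
      exteriorPullback (AbelianVariety.hasExteriorCohomologyH1_complexPoints B)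
        (s : complexBetti B.X 1 →ₗ[ℂ] complexBetti B.X 1) (2 * a) y = y) → y ∈ divisorClassesSpan B.X B.dim a)
    (hhC : hC ∈ hodgeClassSpan C.dim C.X 1) (hCtop : lefschetzPow hC (C.dim - 1) 2 hC ≠ 0)
    (hndC : ∀ z : complexBetti C.X 1, (∀ y, polarizationPairingOne C.X hC (C.dim - 1) z y = 0) → z = 0)
    (recC : ∀ (a : ℕ) (z : complexBetti C.X (2 * a)), (∀ t ∈ unitaryCentralizerGroup C hC,
      exteriorPullback (AbelianVariety.hasExteriorCohomologyH1_complexPoints C)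
        (t : complexBetti C.X 1 →ₗ[ℂ] complexBetti C.X 1) (2 * a) z = z) → z ∈ divisorClassesSpan C.X C.dim a)
    (p : ℕ) (x : complexBetti (B.prod C).X (2 * p))
    (hx : ∀ g ∈ specialLefschetzGroup (B.prod C).dim (B.prod C).X, g (2 * p) x = x) :
    x ∈ divisorClassesSpan (B.prod C).X (B.prod C).dim p := by
  have hP0 : 0 < (B.prod C).dim := by rw [AbelianVariety.dim_prod]; omega
  have hh := prodPolarizationClass_mem_hodgeClassSpan hB hC hhB hhC
  have htop := lefschetzPow_prodPolarizationClass_self_ne_zero hB hC hB0 hC0 hBtop hCtop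
  have hnd := eq_zero_of_forall_polarizationPairingOne_prod_eq_zero hB hC hB0 hC0 hBtop hCtop hndB hndC
  refine mem_divisorClassesSpan_prod_of_forall_exteriorPullback_eq hBC hCB hBtop hCtop recB recC p x
    fun u hu ↦ ?_
  exact hx _ (exteriorPullbackEquiv_mem_specialLefschetzGroup hP0 hh htop hnd hu)

/-- **Cor. 4.5 as an equality of sets on `B × C`**, from the factors: the `S(B × C)`-invariants of
`H²ᵖ((B × C)(ℂ); ℂ)` are EXACTLY `Dᵖ_hom(B × C)_ℂ`. [cite: Milne1999LefschetzClasses, Cor. 4.5 (p. 659) and Prop. 3.4] -/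
theorem setOf_forall_apply_eq_self_eq_divisorClassesSpan_prod
    (hBC : ∀ f : B ⟶ C, f = 0) (hCB : ∀ g : C ⟶ B, g = 0) (hB0 : 0 < B.dim) (hC0 : 0 < C.dim)
    (hhB : hB ∈ hodgeClassSpan B.dim B.X 1) (hBtop : lefschetzPow hB (B.dim - 1) 2 hB ≠ 0)
    (hndB : ∀ z : complexBetti B.X 1, (∀ y, polarizationPairingOne B.X hB (B.dim - 1) z y = 0) → z = 0)
    (recB : ∀ (a : ℕ) (y : complexBetti B.X (2 * a)), (∀ s ∈ unitaryCentralizerGroup B hB,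
      exteriorPullback (AbelianVariety.hasExteriorCohomologyH1_complexPoints B)
        (s : complexBetti B.X 1 →ₗ[ℂ] complexBetti B.X 1) (2 * a) y = y) → y ∈ divisorClassesSpan B.X B.dim a)
    (hhC : hC ∈ hodgeClassSpan C.dim C.X 1) (hCtop : lefschetzPow hC (C.dim - 1) 2 hC ≠ 0)
    (hndC : ∀ z : complexBetti C.X 1, (∀ y, polarizationPairingOne C.X hC (C.dim - 1) z y = 0) → z = 0)
    (recC : ∀ (a : ℕ) (z : complexBetti C.X (2 * a)), (∀ t ∈ unitaryCentralizerGroup C hC,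
      exteriorPullback (AbelianVariety.hasExteriorCohomologyH1_complexPoints C)
        (t : complexBetti C.X 1 →ₗ[ℂ] complexBetti C.X 1) (2 * a) z = z) → z ∈ divisorClassesSpan C.X C.dim a)
    (p : ℕ) :
    {x : complexBetti (B.prod C).X (2 * p) |
        ∀ g ∈ specialLefschetzGroup (B.prod C).dim (B.prod C).X, g (2 * p) x = x} =
      (divisorClassesSpan (B.prod C).X (B.prod C).dim p : Set _) :=
  Set.Subset.antisymm
    (fun x hx ↦ specialLefschetzGroup_invariants_le_prod hBC hCB hB0 hC0 hhB hBtop hndB recB hhC hCtop hndC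
      recC p x hx)
    fun _ hx _ hg ↦ apply_eq_self_of_mem_specialLefschetzGroup hg hx

/-- **Milne Prop. 4.8, (c) ⇒ (a) on `B × C` itself**, from the factors: if `Hg′(B × C) = S(B × C)` then
`B(B × C) = D(B × C)`. [cite: Milne1999LefschetzClasses, Prop. 4.8 and Cor. 4.5 (pp. 659–660)] -/
theorem isDivisorGenerated_prod_of_hodgeGroup_eq_specialLefschetzGroup
    (hBC : ∀ f : B ⟶ C, f = 0) (hCB : ∀ g : C ⟶ B, g = 0) (hB0 : 0 < B.dim) (hC0 : 0 < C.dim)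
    (hhB : hB ∈ hodgeClassSpan B.dim B.X 1) (hBtop : lefschetzPow hB (B.dim - 1) 2 hB ≠ 0)
    (hndB : ∀ z : complexBetti B.X 1, (∀ y, polarizationPairingOne B.X hB (B.dim - 1) z y = 0) → z = 0)
    (recB : ∀ (a : ℕ) (y : complexBetti B.X (2 * a)), (∀ s ∈ unitaryCentralizerGroup B hB,
      exteriorPullback (AbelianVariety.hasExteriorCohomologyH1_complexPoints B)
        (s : complexBetti B.X 1 →ₗ[ℂ] complexBetti B.X 1) (2 * a) y = y) → y ∈ divisorClassesSpan B.X B.dim a)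
    (hhC : hC ∈ hodgeClassSpan C.dim C.X 1) (hCtop : lefschetzPow hC (C.dim - 1) 2 hC ≠ 0)
    (hndC : ∀ z : complexBetti C.X 1, (∀ y, polarizationPairingOne C.X hC (C.dim - 1) z y = 0) → z = 0)
    (recC : ∀ (a : ℕ) (z : complexBetti C.X (2 * a)), (∀ t ∈ unitaryCentralizerGroup C hC,
      exteriorPullback (AbelianVariety.hasExteriorCohomologyH1_complexPoints C)
        (t : complexBetti C.X 1 →ₗ[ℂ] complexBetti C.X 1) (2 * a) z = z) → z ∈ divisorClassesSpan C.X C.dim a)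
    (hHg : hodgeGroup (B.prod C).dim (B.prod C).X = specialLefschetzGroup (B.prod C).dim (B.prod C).X) :
    IsDivisorGenerated (B.prod C) :=
  fun p c hc hpp ↦ specialLefschetzGroup_invariants_le_prod hBC hCB hB0 hC0 hhB hBtop hndB recB hhC hCtop
    hndC recC p c fun _ hg ↦ apply_eq_self_of_mem_hodgeGroup (hHg ▸ hg) hc hpp

end Product

/-! ### §6 Instances: polarization data of the factors, and the new loci -/

section Instances

variable {B C : AbelianVariety ℂ}

/-- **Polarization data on a positive-dimensional complex abelian variety**: the rational Kähler class `h`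
of a projective embedding (`KaehlerRationalDatum`) is rational with a Kähler multiple, lies in `B¹ ⊗ ℂ`,
has `h^{dim} ≠ 0` (Voisin I Cor. 3.9) and a non-degenerate `Q_h` on `H¹` (hard Lefschetz) — Milne's "let `D`
be an ample divisor on `A`". [cite: Milne1999LefschetzClasses, §1 p. 642 (e_D non-degenerate for D ample)]
[cite: VoisinHodgeI2002, §3.1.3 Cor. 3.9, Thm. 6.25 and §7.1.2] -/
theorem exists_polarizationClass (A : AbelianVariety ℂ) (hA0 : 0 < A.dim) :
    ∃ h : complexBetti A.X 2, IsRationalClass h ∧ (∃ s : ℝ, 0 < s ∧ IsKaehlerClass A.dim A.X ((s : ℂ) • h)) ∧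
      h ∈ hodgeClassSpan A.dim A.X 1 ∧ lefschetzPow h (A.dim - 1) 2 h ≠ 0 ∧
      ∀ z : complexBetti A.X 1, (∀ y, polarizationPairingOne A.X h (A.dim - 1) z y = 0) → z = 0 := by
  obtain ⟨D⟩ := nonempty_kaehlerRationalDatum (AbelianVariety.isSmoothProjective_holds (A := A))
  have hQ : IsRationalClass D.Hη := D.isRationalClass_Hη
  have hK1 : IsKaehlerClass A.dim A.X (((1 : ℝ) : ℂ) • D.Hη) := by
    rw [Complex.ofReal_one, one_smul]
    exact D.isKaehlerClassVia.isKaehlerClass D.isNatural D.isMultiplicative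
  exact ⟨D.Hη, hQ, ⟨1, one_pos, hK1⟩, mem_hodgeClassSpan_one_of_isKaehlerClass_smul hQ one_ne_zero hK1,
    lefschetzPow_self_ne_zero_of_isKaehlerClass_smul hA0 hK1,
    eq_zero_of_forall_polarizationPairingOne_eq_zero_of_isKaehlerClass_smul' one_ne_zero hK1⟩

/-- **The record for `B × C` from records "for SOME polarization class" on the factors** (the shape in which
the proved loci deliver it: `∃ h` rational with a Kähler multiple such that the `S(h)(ℂ)`-invariants are
Lefschetz): for `Hom(B, C) = 0 = Hom(C, B)` and positive-dimensional factors.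
[cite: Milne1999LefschetzClasses, Prop. 3.4 (p. 654), Lemma 3.1, Cor. 4.5 (p. 659)] -/
theorem specialLefschetzGroup_invariants_le_prod_of_exists
    (hBC : ∀ f : B ⟶ C, f = 0) (hCB : ∀ g : C ⟶ B, g = 0) (hB0 : 0 < B.dim) (hC0 : 0 < C.dim)
    (hrecB : ∃ hB : complexBetti B.X 2, IsRationalClass hB ∧
      (∃ s : ℝ, 0 < s ∧ IsKaehlerClass B.dim B.X ((s : ℂ) • hB)) ∧
      ∀ (a : ℕ) (y : complexBetti B.X (2 * a)), (∀ s ∈ unitaryCentralizerGroup B hB,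
        exteriorPullback (AbelianVariety.hasExteriorCohomologyH1_complexPoints B)
          (s : complexBetti B.X 1 →ₗ[ℂ] complexBetti B.X 1) (2 * a) y = y) → y ∈ divisorClassesSpan B.X B.dim a)
    (hrecC : ∃ hC : complexBetti C.X 2, IsRationalClass hC ∧
      (∃ s : ℝ, 0 < s ∧ IsKaehlerClass C.dim C.X ((s : ℂ) • hC)) ∧
      ∀ (a : ℕ) (z : complexBetti C.X (2 * a)), (∀ t ∈ unitaryCentralizerGroup C hC,
        exteriorPullback (AbelianVariety.hasExteriorCohomologyH1_complexPoints C)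
          (t : complexBetti C.X 1 →ₗ[ℂ] complexBetti C.X 1) (2 * a) z = z) → z ∈ divisorClassesSpan C.X C.dim a)
    (p : ℕ) (x : complexBetti (B.prod C).X (2 * p))
    (hx : ∀ g ∈ specialLefschetzGroup (B.prod C).dim (B.prod C).X, g (2 * p) x = x) :
    x ∈ divisorClassesSpan (B.prod C).X (B.prod C).dim p := by
  obtain ⟨hB, hQB, ⟨sB, hsB, hKB⟩, recB⟩ := hrecB
  obtain ⟨hC, hQC, ⟨sC, hsC, hKC⟩, recC⟩ := hrecC
  exact specialLefschetzGroup_invariants_le_prod hBC hCB hB0 hC0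
    (mem_hodgeClassSpan_one_of_isKaehlerClass_smul hQB hsB.ne' hKB)
    (lefschetzPow_self_ne_zero_of_isKaehlerClass_smul hB0 hKB)
    (eq_zero_of_forall_polarizationPairingOne_eq_zero_of_isKaehlerClass_smul' hsB.ne' hKB) recB
    (mem_hodgeClassSpan_one_of_isKaehlerClass_smul hQC hsC.ne' hKC)
    (lefschetzPow_self_ne_zero_of_isKaehlerClass_smul hC0 hKC)
    (eq_zero_of_forall_polarizationPairingOne_eq_zero_of_isKaehlerClass_smul' hsC.ne' hKC) recC p x hx

/-- **The record for `B × C` with `End(B)` commutative and `B(C) = D(C)`**, `Hom(B, C) = 0 = Hom(C, B)`,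
positive-dimensional factors (e.g. a simple abelian variety of type I or IV with `d = 1` times an abelian
variety of dimension `≤ 3` of any Albert type, or times a product of powers of elliptic curves): the
`S(ℂ)`-forms of the record on the factors are the tree's
`mem_divisorClassesSpan_of_forall_exteriorPullback_eq_of_forall_comp_comm`
(`Milne1999/SpecialLefschetzGroupInvariantsCommutativeEnd`) and
`mem_divisorClassesSpan_of_forall_exteriorPullback_eq_of_isDivisorGenerated`
(`Milne1999/SpecialLefschetzGroupInvariantsHodgeClasses`). [cite: Milne1999LefschetzClasses, Prop. 3.4 (p. 654), Cor. 4.5 (p. 659)] -/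
theorem specialLefschetzGroup_invariants_le_prod_of_forall_comp_comm_of_isDivisorGenerated
    (hBC : ∀ f : B ⟶ C, f = 0) (hCB : ∀ g : C ⟶ B, g = 0) (hB0 : 0 < B.dim) (hC0 : 0 < C.dim)
    (hcomm : ∀ φ ψ : B ⟶ B, φ ≫ ψ = ψ ≫ φ) (hD : IsDivisorGenerated C)
    (p : ℕ) (x : complexBetti (B.prod C).X (2 * p))
    (hx : ∀ g ∈ specialLefschetzGroup (B.prod C).dim (B.prod C).X, g (2 * p) x = x) :
    x ∈ divisorClassesSpan (B.prod C).X (B.prod C).dim p := by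
  obtain ⟨hB, hQB, hKB, -, -, -⟩ := exists_polarizationClass B hB0
  obtain ⟨hC, hQC, hKC, hhC, -, -⟩ := exists_polarizationClass C hC0
  exact specialLefschetzGroup_invariants_le_prod_of_exists hBC hCB hB0 hC0
    ⟨hB, hQB, hKB, fun a y hy ↦
      mem_divisorClassesSpan_of_forall_exteriorPullback_eq_of_forall_comp_comm hcomm hQB hKB a y hy⟩
    ⟨hC, hQC, hKC, fun a z hz ↦
      mem_divisorClassesSpan_of_forall_exteriorPullback_eq_of_isDivisorGenerated hD hhC a z hz⟩ p x hx

/-- **The record for `B × C` with `B(B) = D(B)` and `End(C)` commutative** (the factors in the other order).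
[cite: Milne1999LefschetzClasses, Prop. 3.4 (p. 654), Cor. 4.5 (p. 659)] -/
theorem specialLefschetzGroup_invariants_le_prod_of_isDivisorGenerated_of_forall_comp_comm
    (hBC : ∀ f : B ⟶ C, f = 0) (hCB : ∀ g : C ⟶ B, g = 0) (hB0 : 0 < B.dim) (hC0 : 0 < C.dim)
    (hD : IsDivisorGenerated B) (hcomm : ∀ φ ψ : C ⟶ C, φ ≫ ψ = ψ ≫ φ)
    (p : ℕ) (x : complexBetti (B.prod C).X (2 * p))
    (hx : ∀ g ∈ specialLefschetzGroup (B.prod C).dim (B.prod C).X, g (2 * p) x = x) :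
    x ∈ divisorClassesSpan (B.prod C).X (B.prod C).dim p := by
  obtain ⟨hB, hQB, hKB, hhB, -, -⟩ := exists_polarizationClass B hB0
  obtain ⟨hC, hQC, hKC, -, -, -⟩ := exists_polarizationClass C hC0
  exact specialLefschetzGroup_invariants_le_prod_of_exists hBC hCB hB0 hC0
    ⟨hB, hQB, hKB, fun a y hy ↦
      mem_divisorClassesSpan_of_forall_exteriorPullback_eq_of_isDivisorGenerated hD hhB a y hy⟩
    ⟨hC, hQC, hKC, fun a z hz ↦
      mem_divisorClassesSpan_of_forall_exteriorPullback_eq_of_forall_comp_comm hcomm hQC hKC a z hz⟩ p x hx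

/-- **The record for `B × C` with `B(B) = D(B)` and `B(C) = D(C)`**, `Hom(B, C) = 0 = Hom(C, B)` (note that
`B(B × C) = D(B × C)` need NOT follow: the Hodge group of a product of Hom-orthogonal factors can be smaller
than the product of the Hodge groups). [cite: Milne1999LefschetzClasses, Prop. 3.4 (p. 654), Cor. 4.5 (p. 659)] -/
theorem specialLefschetzGroup_invariants_le_prod_of_isDivisorGenerated
    (hBC : ∀ f : B ⟶ C, f = 0) (hCB : ∀ g : C ⟶ B, g = 0) (hB0 : 0 < B.dim) (hC0 : 0 < C.dim)
    (hDB : IsDivisorGenerated B) (hDC : IsDivisorGenerated C)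
    (p : ℕ) (x : complexBetti (B.prod C).X (2 * p))
    (hx : ∀ g ∈ specialLefschetzGroup (B.prod C).dim (B.prod C).X, g (2 * p) x = x) :
    x ∈ divisorClassesSpan (B.prod C).X (B.prod C).dim p := by
  obtain ⟨hB, hQB, hKB, hhB, -, -⟩ := exists_polarizationClass B hB0
  obtain ⟨hC, hQC, hKC, hhC, -, -⟩ := exists_polarizationClass C hC0
  exact specialLefschetzGroup_invariants_le_prod_of_exists hBC hCB hB0 hC0
    ⟨hB, hQB, hKB, fun a y hy ↦
      mem_divisorClassesSpan_of_forall_exteriorPullback_eq_of_isDivisorGenerated hDB hhB a y hy⟩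
    ⟨hC, hQC, hKC, fun a z hz ↦
      mem_divisorClassesSpan_of_forall_exteriorPullback_eq_of_isDivisorGenerated hDC hhC a z hz⟩ p x hx

/-- **The record for `B × C` with `End(B)` and `End(C)` commutative**, `Hom(B, C) = 0 = Hom(C, B)` — here
`End(B × C)` is again commutative, so this case is also covered by
`specialLefschetzGroup_invariants_le_of_forall_comp_comm`; recorded as the product road to it.
[cite: Milne1999LefschetzClasses, Prop. 3.4 (p. 654), Cor. 4.5 (p. 659)] -/
theorem specialLefschetzGroup_invariants_le_prod_of_forall_comp_comm
    (hBC : ∀ f : B ⟶ C, f = 0) (hCB : ∀ g : C ⟶ B, g = 0) (hB0 : 0 < B.dim) (hC0 : 0 < C.dim)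
    (hcommB : ∀ φ ψ : B ⟶ B, φ ≫ ψ = ψ ≫ φ) (hcommC : ∀ φ ψ : C ⟶ C, φ ≫ ψ = ψ ≫ φ)
    (p : ℕ) (x : complexBetti (B.prod C).X (2 * p))
    (hx : ∀ g ∈ specialLefschetzGroup (B.prod C).dim (B.prod C).X, g (2 * p) x = x) :
    x ∈ divisorClassesSpan (B.prod C).X (B.prod C).dim p := by
  obtain ⟨hB, hQB, hKB, -, -, -⟩ := exists_polarizationClass B hB0
  obtain ⟨hC, hQC, hKC, -, -, -⟩ := exists_polarizationClass C hC0
  exact specialLefschetzGroup_invariants_le_prod_of_exists hBC hCB hB0 hC0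
    ⟨hB, hQB, hKB, fun a y hy ↦
      mem_divisorClassesSpan_of_forall_exteriorPullback_eq_of_forall_comp_comm hcommB hQB hKB a y hy⟩
    ⟨hC, hQC, hKC, fun a z hz ↦
      mem_divisorClassesSpan_of_forall_exteriorPullback_eq_of_forall_comp_comm hcommC hQC hKC a z hz⟩ p x hx

end Instances

end Literature.AlgebraicGeometry.Milne1999

end
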